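import Summits.QuantumFields.BalabanUV.Beta.EriceRemainderEnclosureHistoryAutonomyComparisonDefectOscillation

/-!
# EriceRemainderEnclosureHistoryAutonomyComparisonDefectOscillationRatio — (E140d) **A SIGN-FREE EXCESS COSTS AT MOST A SCALE-UNIFORM FACTOR: `h′ ≤ h∕√(1 − κ)`,
# `κ = θδ∕((1−θ)b)`.**  (E140c) bounds the level deficit of the perturbed orbit by `j·θδ∕(1−θ)` at scale `j`; the floor makes the base level itself grow at least like
# `1∕p² + j·b` ((E138a) `level_ge_pin_add`), so the deficit is at most the FIXED FRACTION `κ = θδ∕((1−θ)b)` of the base level: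
#   **`(1 − κ)∕h_j² ≤ 1∕h′_j²`** (`level_ratio_le`) and, for `κ < 1`, **`h′_j ≤ h_j∕√(1−κ)` at EVERY scale** (`coupling_ratio_le`).
# So over an isotone memory of level-Lipschitz age moment `θ < 1` EVERY bounded sign-free excess (`τ = 0`, `δ = sup D − inf D`) is ENCLOSED up to a scale-uniform
# multiplicative constant — comparison proper (`κ = 0`) being the case of an isotone excess ((E138)) or of the defect law ((E140a)); for two-sided excesses
# `ε_lo ≤ B′ − B ≤ ε_hi` the factor is `(1 − θ(ε_hi − ε_lo)∕((1−θ)b))^{−1∕2}` (`two_sided_ratio`), and it is `1` as soon as `θ·ε_hi ≤ ε_lo` ((E140a) `le_of_two_sided_excess`).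

Cell `pub-balaban`, β-function sub-cell, BINDER row D4 «RemainderConst leaves for Bałaban's split» (`HOME/BINDER-OWNERS.md`; owner lineage `b2b-balaban-beta-an4`;
this file by co-owner #2 lineage `b2b-balaban-beta-d4-p2`, generation 108), β-FLOW TEAM duty (1), FREEZE (0) honoured (def-free; (E140c) `level_deficit_le`, (E138a)
`level_ge_pin_add` BY NAME; nothing restated).

HONEST FRAMING (page 1, verbatim and binding).  *"Discharging BetaPertH makes Bałaban's UV stability UNCONDITIONAL — a real constructive-QFT result; it is
NOT the continuum limit and NOT the Clay problem."*  THIS FILE DISCHARGES NOTHING OF THE KIND.  Elementary real analysis about ABSTRACT functionals on a box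
]0,γ]^ℕ (node U2's `MemFlow` ∕ `SeqBox`) — hypotheses of a census, not facts: nothing about Bałaban's (1.22) limit functional or any remainder perturbation of it is
PRINTED in this form ([I] p. 298; GAPS G-t4-U2-1∕-2) or asserted.  Row D4 class UNCHANGED (critical-path width 0; instance 0∕1; D4 DISCHARGE NO DATE).  NOT B12 Thm 2,
NOT BetaPertH, NOT continuum YM, NOT Clay.

WHAT IS PROVED ([folklore]; 0 `def`, 0 sorry).  §1 **`level_ratio_le`**, **`coupling_ratio_le`**.  §2 **`two_sided_ratio`**.
-/

noncomputable section
open Finset Set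

namespace Summit.QuantumFields.BalabanUV.Beta.EriceRemainderEnclosureHistoryAutonomyComparisonDefectOscillationRatio

open Literature.MathematicalPhysics.QuantumFieldTheory.Balaban1983to89
open Literature.MathematicalPhysics.QuantumFieldTheory.Balaban1983to89.T4BetaStationary
open Literature.MathematicalPhysics.QuantumFieldTheory.Balaban1983to89.T4BetaFlowWellPosed
open Summit.QuantumFields.BalabanUV.Beta.EriceRemainderEnclosureHistoryAutonomyComparisonDualContractionLinks (level_ge_pin_add)
open Summit.QuantumFields.BalabanUV.Beta.EriceRemainderEnclosureHistoryAutonomyComparisonDefectOscillation (level_deficit_le)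

variable {B B' : (ℕ → ℝ) → ℝ} {M γ b : ℝ} {h h' : ℕ → ℝ}

/-! ## §1 The deficit is a fixed fraction of the base level -/

/-- **THE LEVEL RATIO.**  (E140c)'s class: `B` isotone on `]0,γ]^ℕ` (zeroth moment `M`, floor `b > 0`), level-Lipschitz age profile `Λ ≥ 0` on the graded box with
`θ = Σ_{k<K} k·Λ_k < 1`; `B ≤ B′ ≤ β̄` with excess `u ≤ v ⟹ (B′−B)u ≤ (1+τ)(B′−B)v + δ` (`τ, δ ≥ 0`), `(1+τ)θ ≤ 1`; `h, h′` box solutions of `B, B′` from one pin `p`.  Then with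
`κ := θδ∕((1−θ)b)`:  **`(1 − κ)·(1∕h_j²) ≤ 1∕h′_j²`** at every scale — the deficit `j·θδ∕(1−θ)` of (E140c) is at most `κ` times the base level, which is `≥ 1∕p² + j·b`.
[folklore] -/
theorem level_ratio_le {Λ : ℕ → ℝ} {K : ℕ} {βb p τ δ : ℝ}
    (hmono : ∀ u v : ℕ → ℝ, SeqBox γ u → SeqBox γ v → (∀ i, u i ≤ v i) → B u ≤ B v)
    (hB : ∀ u u' : ℕ → ℝ, SeqBox γ u → SeqBox γ u' → ∀ D : ℝ, (∀ j, |u j - u' j| ≤ D) → |B u - B u'| ≤ M * D) (hM : 0 ≤ M)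
    (hb : 0 < b) (hlo : ∀ u, SeqBox γ u → b ≤ B u)
    (hΛ : ∀ k, 0 ≤ Λ k) (hθ : ∑ k ∈ range K, (k : ℝ) * Λ k < 1)
    (hτ : 0 ≤ τ) (hθτ : (1 + τ) * ∑ k ∈ range K, (k : ℝ) * Λ k ≤ 1) (hδ : 0 ≤ δ)
    (hLip : ∀ u v : ℕ → ℝ, SeqBox γ u → SeqBox γ v → (∀ k : ℕ, 1 / γ ^ 2 + ((k : ℝ) + 1) * b ≤ 1 / u k ^ 2) →
      (∀ k : ℕ, 1 / γ ^ 2 + ((k : ℝ) + 1) * b ≤ 1 / v k ^ 2) → B u - B v ≤ ∑ k ∈ range K, Λ k * max (1 / v k ^ 2 - 1 / u k ^ 2) 0)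
    (hexc : ∀ u, SeqBox γ u → B u ≤ B' u) (hbdd : ∀ u, SeqBox γ u → B' u ≤ βb)
    (hDosc : ∀ u v : ℕ → ℝ, SeqBox γ u → SeqBox γ v → (∀ i, u i ≤ v i) → B' u - B u ≤ (1 + τ) * (B' v - B v) + δ)
    (hp : 0 < p) (hpγ : p ≤ γ) (hh : SeqBox γ h) (hf : MemFlow B p h) (hh' : SeqBox γ h') (hf' : MemFlow B' p h') (j : ℕ) :
    (1 - (∑ k ∈ range K, (k : ℝ) * Λ k) * δ / (1 - ∑ k ∈ range K, (k : ℝ) * Λ k) / b) * (1 / h j ^ 2) ≤ 1 / h' j ^ 2 := by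
  have hdef := level_deficit_le hmono hB hM hb hlo hΛ hθ hτ hθτ hδ hLip hexc hbdd hDosc hp hpγ hh hf hh' hf' j
  set θ : ℝ := ∑ k ∈ range K, (k : ℝ) * Λ k with hθdef
  set F : ℝ := θ * δ / (1 - θ) with hFdef
  have hθ0 : 0 ≤ θ := sum_nonneg fun k _ => mul_nonneg (Nat.cast_nonneg k) (hΛ k)
  have hF0 : 0 ≤ F := div_nonneg (mul_nonneg hθ0 hδ) (by linarith)
  -- the base level grows at least linearly: 1∕p² + j·b ≤ 1∕h_j²
  have hgrow := level_ge_pin_add hlo hh hf j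
  have hp2 : 0 < 1 / p ^ 2 := by positivity
  -- j·F ≤ (F∕b)·(1∕h_j²)
  have hjF : (j : ℝ) * F ≤ F / b * (1 / h j ^ 2) := by
    rw [div_mul_eq_mul_div, le_div_iff₀ hb]
    have : (j : ℝ) * b ≤ 1 / h j ^ 2 := by linarith
    nlinarith
  have e : (1 - F / b) * (1 / h j ^ 2) = 1 / h j ^ 2 - F / b * (1 / h j ^ 2) := by ring
  rw [e]
  linarith

/-- **THE COUPLING RATIO: `h′_j ≤ h_j ∕ √(1 − κ)` AT EVERY SCALE** (`κ = θδ∕((1−θ)b) < 1`) — a sign-free excess with oscillation `δ` over an isotone memory of age moment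
`θ < 1` and floor `b` can lift the running coupling above the base orbit by at most the SCALE-UNIFORM factor `(1−κ)^{−1∕2}`. [folklore] -/
theorem coupling_ratio_le {Λ : ℕ → ℝ} {K : ℕ} {βb p τ δ : ℝ}
    (hmono : ∀ u v : ℕ → ℝ, SeqBox γ u → SeqBox γ v → (∀ i, u i ≤ v i) → B u ≤ B v)
    (hB : ∀ u u' : ℕ → ℝ, SeqBox γ u → SeqBox γ u' → ∀ D : ℝ, (∀ j, |u j - u' j| ≤ D) → |B u - B u'| ≤ M * D) (hM : 0 ≤ M)
    (hb : 0 < b) (hlo : ∀ u, SeqBox γ u → b ≤ B u)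
    (hΛ : ∀ k, 0 ≤ Λ k) (hθ : ∑ k ∈ range K, (k : ℝ) * Λ k < 1)
    (hτ : 0 ≤ τ) (hθτ : (1 + τ) * ∑ k ∈ range K, (k : ℝ) * Λ k ≤ 1) (hδ : 0 ≤ δ)
    (hκ : (∑ k ∈ range K, (k : ℝ) * Λ k) * δ / (1 - ∑ k ∈ range K, (k : ℝ) * Λ k) < b)
    (hLip : ∀ u v : ℕ → ℝ, SeqBox γ u → SeqBox γ v → (∀ k : ℕ, 1 / γ ^ 2 + ((k : ℝ) + 1) * b ≤ 1 / u k ^ 2) →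
      (∀ k : ℕ, 1 / γ ^ 2 + ((k : ℝ) + 1) * b ≤ 1 / v k ^ 2) → B u - B v ≤ ∑ k ∈ range K, Λ k * max (1 / v k ^ 2 - 1 / u k ^ 2) 0)
    (hexc : ∀ u, SeqBox γ u → B u ≤ B' u) (hbdd : ∀ u, SeqBox γ u → B' u ≤ βb)
    (hDosc : ∀ u v : ℕ → ℝ, SeqBox γ u → SeqBox γ v → (∀ i, u i ≤ v i) → B' u - B u ≤ (1 + τ) * (B' v - B v) + δ)
    (hp : 0 < p) (hpγ : p ≤ γ) (hh : SeqBox γ h) (hf : MemFlow B p h) (hh' : SeqBox γ h') (hf' : MemFlow B' p h') (j : ℕ) :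
    h' j ≤ h j / Real.sqrt (1 - (∑ k ∈ range K, (k : ℝ) * Λ k) * δ / (1 - ∑ k ∈ range K, (k : ℝ) * Λ k) / b) := by
  have hrat := level_ratio_le hmono hB hM hb hlo hΛ hθ hτ hθτ hδ hLip hexc hbdd hDosc hp hpγ hh hf hh' hf' j
  set θ : ℝ := ∑ k ∈ range K, (k : ℝ) * Λ k with hθdef
  set κ : ℝ := θ * δ / (1 - θ) / b with hκdef
  have hκ1 : κ < 1 := by rw [hκdef, div_lt_one hb]; exact hκ
  have h1κ : 0 < 1 - κ := by linarith
  have hpj : 0 < h j := (hh j).1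
  have hpj' : 0 < h' j := (hh' j).1
  -- (1−κ)·h′_j² ≤ h_j²
  have hsq : (1 - κ) * h' j ^ 2 ≤ h j ^ 2 := by
    have h1 : (1 - κ) * (1 / h j ^ 2) ≤ 1 / h' j ^ 2 := hrat
    rw [mul_one_div, div_le_div_iff₀ (pow_pos hpj 2) (pow_pos hpj' 2), one_mul] at h1
    linarith
  -- take square roots
  have hs1 : Real.sqrt (1 - κ) * h' j ≤ h j := by
    have e1 : Real.sqrt ((1 - κ) * h' j ^ 2) = Real.sqrt (1 - κ) * h' j := by
      rw [Real.sqrt_mul h1κ.le, Real.sqrt_sq hpj'.le]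
    have e2 : Real.sqrt (h j ^ 2) = h j := Real.sqrt_sq hpj.le
    have := Real.sqrt_le_sqrt hsq
    rwa [e1, e2] at this
  rw [le_div_iff₀ (Real.sqrt_pos.mpr h1κ), mul_comm]
  exact hs1

/-! ## §2 Two-sided excesses -/

/-- **TWO-SIDED SIGN-FREE EXCESSES ARE ENCLOSED UP TO A SCALE-UNIFORM FACTOR.**  `B`: isotone on `]0,γ]^ℕ`, zeroth moment `M`, floor `b > 0`, level-Lipschitz age profile
`Λ ≥ 0` on the graded box with `θ = Σ_{k<K} k·Λ_k < 1`.  `B′`: ANY functional with two-sided excess `ε_lo ≤ B′ u − B u ≤ ε_hi` on the box (NO sign structure, `ε_lo` may be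
`0`) and `B′ ≤ β̄`.  If `κ := θ(ε_hi − ε_lo)∕((1−θ)b) < 1` then for ANY box solutions `h, h′` of `B, B′` from one pin and every scale `j`:
**`h′_j ≤ h_j ∕ √(1 − κ)`**.  (When moreover `θ·ε_hi ≤ ε_lo`, (E140a) `le_of_two_sided_excess` gives `h′ ≤ h` itself.)  The excess has `τ = 0`, `δ = ε_hi − ε_lo` in
(E140c)'s letters. [folklore] -/
theorem two_sided_ratio {Λ : ℕ → ℝ} {K : ℕ} {βb p εlo εhi : ℝ}
    (hmono : ∀ u v : ℕ → ℝ, SeqBox γ u → SeqBox γ v → (∀ i, u i ≤ v i) → B u ≤ B v)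
    (hB : ∀ u u' : ℕ → ℝ, SeqBox γ u → SeqBox γ u' → ∀ D : ℝ, (∀ j, |u j - u' j| ≤ D) → |B u - B u'| ≤ M * D) (hM : 0 ≤ M)
    (hb : 0 < b) (hlo : ∀ u, SeqBox γ u → b ≤ B u)
    (hΛ : ∀ k, 0 ≤ Λ k) (hθ : ∑ k ∈ range K, (k : ℝ) * Λ k < 1)
    (hεlo : 0 ≤ εlo)
    (hκ : (∑ k ∈ range K, (k : ℝ) * Λ k) * (εhi - εlo) / (1 - ∑ k ∈ range K, (k : ℝ) * Λ k) < b)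
    (hLip : ∀ u v : ℕ → ℝ, SeqBox γ u → SeqBox γ v → (∀ k : ℕ, 1 / γ ^ 2 + ((k : ℝ) + 1) * b ≤ 1 / u k ^ 2) →
      (∀ k : ℕ, 1 / γ ^ 2 + ((k : ℝ) + 1) * b ≤ 1 / v k ^ 2) → B u - B v ≤ ∑ k ∈ range K, Λ k * max (1 / v k ^ 2 - 1 / u k ^ 2) 0)
    (htwo : ∀ u, SeqBox γ u → εlo ≤ B' u - B u ∧ B' u - B u ≤ εhi) (hbdd : ∀ u, SeqBox γ u → B' u ≤ βb)
    (hp : 0 < p) (hpγ : p ≤ γ) (hh : SeqBox γ h) (hf : MemFlow B p h) (hh' : SeqBox γ h') (hf' : MemFlow B' p h') (j : ℕ) :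
    h' j ≤ h j / Real.sqrt (1 - (∑ k ∈ range K, (k : ℝ) * Λ k) * (εhi - εlo) / (1 - ∑ k ∈ range K, (k : ℝ) * Λ k) / b) := by
  -- the box is inhabited by the constant configuration at the pin, so ε_lo ≤ ε_hi
  have hcst : SeqBox γ (fun _ => p) := fun _ => ⟨hp, hpγ⟩
  have hδ : 0 ≤ εhi - εlo := by linarith [(htwo _ hcst).1.trans (htwo _ hcst).2]
  have hθ0 : 0 ≤ ∑ k ∈ range K, (k : ℝ) * Λ k := sum_nonneg fun k _ => mul_nonneg (Nat.cast_nonneg k) (hΛ k)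
  have hθτ : (1 + (0 : ℝ)) * ∑ k ∈ range K, (k : ℝ) * Λ k ≤ 1 := by linarith
  have hexc : ∀ u, SeqBox γ u → B u ≤ B' u := fun u hu => by linarith [(htwo u hu).1]
  have hDosc : ∀ u v : ℕ → ℝ, SeqBox γ u → SeqBox γ v → (∀ i, u i ≤ v i) →
      B' u - B u ≤ (1 + (0 : ℝ)) * (B' v - B v) + (εhi - εlo) := by
    intro u v hu hv _
    linarith [(htwo u hu).2, (htwo v hv).1]
  exact coupling_ratio_le hmono hB hM hb hlo hΛ hθ le_rfl hθτ hδ hκ hLip hexc hbdd hDosc hp hpγ hh hf hh' hf' j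

end Summit.QuantumFields.BalabanUV.Beta.EriceRemainderEnclosureHistoryAutonomyComparisonDefectOscillationRatio

end
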